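import Literature.NumberTheory.Rogawski1990.TypeThreeCubicTorusNonsplit
import Literature.NumberTheory.Automorphic.AnisotropicUnitaryGroupCompact      -- ★ `HermitianLattice.isCompact_setOf_v_le_exp_int`
import Literature.NumberTheory.Automorphic.AdicCompletionCompact              -- ★ `compactSpace_integer_adicCompletion`
import HarnessLib

/-!
# The cubic torus is a CARTAN subgroup: it is the centraliser of each of its regular elements, and it is COMPACT
# ([Rogawski1990] §3.6, type (3) — an elliptic Cartan subgroup of `U(Φ₃)(L⁺_v)`)

Topic `NumberTheory/Rogawski1990`; namespace `Literature.NumberTheory.Rogawski1990.TypeThreeTorus`.  THEOREMS ONLY (no definition, no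
instance, no notation, no named fact, no `sorry`); kernel lane `--supports stmt-HodgeConjecture-24833`.  Sequel of ★ `TypeThreeCubicTorusAlgebra`
(FILE A) and ★ `TypeThreeCubicTorusNonsplit` (FILE B: the torus `T ≤ U(Φ₃)(L⁺_v)` attached to `a = ϖ·σ_w ϖ`, ★ `exists_typeThree_cartan_of_elt`).

* §1 (generic field, `a` not a cube) **`commute_companion_of_commute_cubicMat`**: a matrix commuting with a NON-SCALAR `M(p,q,r) = p + qC + rC²`
  commutes with `C` — because `K[C] = K[x]/(x³ − a)` is a field of PRIME degree, `K[qC + rC²] = K[C]`; explicitly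
  `(q³ − a r³)·C = 2aqr²·1 + q²·N − r·N²` with `N = qC + rC²`, and `q³ − a r³ ≠ 0` since `a` is not a cube.  Hence, in the CM
  instantiation (§3), **`T` is the centraliser in `U(Φ₃)(L⁺_v)` of EACH of its regular elements** — a Cartan subgroup in the sense of
  [Rogawski1990, §3.1], junction with ★ `compactCore_centralizer_local_facts_of_isRegularElt`.
* §2 (valued field, `v(a) = exp(−2)`) **the cubic norm form reads the valuation**: the three pure terms of `det M(p,q,r) = p³ + aq³ + a²r³ − 3apqr`
  have orders `≡ 0, 2, 1 (mod 3)`, pairwise distinct, and the cross term is strictly deeper; so `|det M| = 1` (unitary elements) BOUNDS the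
  coordinates: `v p ≤ 1`, `v q ≤ 1`, `v r ≤ exp 1`.
* §3 (CM, non-split `v`): `isCompact_setOf_commute_companion` (the unitary elements of the one-place model commuting with `C_a` form a compact set:
  a continuous image of a closed subset of three compact balls of `L_w`), the HEAD **`exists_typeThree_cartan_elliptic`** = ★ FILE B's
  `exists_typeThree_cartan_of_elt` at `a = ϖ·σ_w ϖ` + «`Z(γ) = T` for regular `γ ∈ T`» + «`T` is COMPACT» (the ELLIPTIC half of «type (3) is an
  elliptic Cartan subgroup», which the mass-one Haar `𝔇.μT T` of ★ `Ch12Sec5Defs.EllipticData` presupposes), and its `Gqs L v`-typed export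
  **`exists_typeThree_cartan_elliptic_gqs`**.
* §4 (ED. 2) the same valuation identity and bounds for ANY order `v a = exp k` with `3 ∤ k` (`v_det_cubicMat_eq_max_of_not_dvd`,
  `v_pure_le_one_of_v_det_cubicMat_eq_one_of_not_dvd`) — the shape needed by the imaginary Kummer parameter of the ★ «CAYLEY ∕ T3» family.
HONEST LABEL: count-neutral floor asset for the (S-𝔇) DAT road of line LH6; HC_CM is proved only modulo the cell's printed citations (2 remaining
named inputs hLiu418 24832, h413 24833) until rung 0 closes; unconditional.

## References
* [Rogawski1990] J. D. Rogawski, *Automorphic Representations of Unitary Groups in Three Variables*, Ann. of Math. Stud. 123 (1990), §3.1 p. 19,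
  §3.6 p. 31, §12.5 p. 184, Lemma 12.7.2 (proof) p. 194.
* [PlatonovRapinchuk1994] V. Platonov, A. Rapinchuk, *Algebraic Groups and Number Theory* (1994), §6.4 Prop. 6.15, Thm. 6.13 (anisotropic tori
  over local fields are compact).
-/

set_option autoImplicit false

noncomputable section

open scoped MatrixGroups Matrix Topology
open Matrix Polynomial Filter NumberField IsDedekindDomain
open Literature.NumberTheory.Automorphic Literature.NumberTheory.Automorphic.UnitaryGroup

namespace Literature.NumberTheory.Rogawski1990.TypeThreeTorus

/-! ## §1 A matrix commuting with a non-scalar element of `K[C]` commutes with `C` -/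

section Field

variable {K : Type*} [Field K]

/-- `M(p,q,r) = p•1 + M(0,q,r)`. [cite: Rogawski1990, §3.6 p. 31] -/
theorem cubicMat_eq_smul_one_add (a p q r : K) :
    !![p, a * r, a * q; q, p, a * r; r, q, p] = p • (1 : Matrix (Fin 3) (Fin 3) K) + !![0, a * r, a * q; q, 0, a * r; r, q, 0] := by
  rw [one_fin_three]
  ext i j; fin_cases i <;> fin_cases j <;> simp

/-- **The key linear relation in `K[C]`**: with `N = qC + rC² = M(0,q,r)`, `(q³ − a r³)·C = 2aqr²·1 + q²·N − r·N²` (coordinates of `1, N, N²`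
in the basis `(1, C, C²)` are `(1,0,0)`, `(0,q,r)`, `(2aqr, ar², q²)`). [cite: Rogawski1990, §3.6 p. 31] -/
theorem smul_companion_eq (a q r : K) :
    (q ^ 3 - a * r ^ 3) • !![(0 : K), 0, a; 1, 0, 0; 0, 1, 0] =
      (2 * a * q * r ^ 2) • (1 : Matrix (Fin 3) (Fin 3) K) + q ^ 2 • !![0, a * r, a * q; q, 0, a * r; r, q, 0] -
        r • (!![0, a * r, a * q; q, 0, a * r; r, q, 0] * !![0, a * r, a * q; q, 0, a * r; r, q, 0]) := by
  rw [cubicMat_mul, one_fin_three]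
  ext i j; fin_cases i <;> fin_cases j <;> simp <;> ring

/-- `q³ − a r³ ≠ 0` when `(q, r) ≠ (0, 0)` and `a` is not a cube. [cite: Rogawski1990, §3.6 p. 31] -/
theorem cube_sub_mul_cube_ne_zero {a q r : K} (hcube : ∀ b : K, b ^ 3 ≠ a) (hqr : ¬ (q = 0 ∧ r = 0)) : q ^ 3 - a * r ^ 3 ≠ 0 := by
  intro h
  rcases eq_or_ne r 0 with hr | hr
  · subst hr
    apply hqr
    refine ⟨?_, rfl⟩
    simpa using h
  · apply hcube (q / r)
    rw [div_pow, div_eq_iff (pow_ne_zero 3 hr)]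
    linear_combination h

/-- **A matrix commuting with a NON-SCALAR element `M(p,q,r)` of the cubic torus algebra commutes with `C`** (`a` not a cube): `K[M(p,q,r)] = K[C]`
since `K[C]` is a field of prime degree `3` — the algebraic heart of «`T` is the centraliser of each of its regular elements».
[cite: Rogawski1990, §3.6 p. 31; §3.1 p. 19] -/
theorem commute_companion_of_commute_cubicMat {a p q r : K} (hcube : ∀ b : K, b ^ 3 ≠ a) (hqr : ¬ (q = 0 ∧ r = 0))
    (g : Matrix (Fin 3) (Fin 3) K) (h : g * !![p, a * r, a * q; q, p, a * r; r, q, p] = !![p, a * r, a * q; q, p, a * r; r, q, p] * g) :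
    g * !![(0 : K), 0, a; 1, 0, 0; 0, 1, 0] = !![(0 : K), 0, a; 1, 0, 0; 0, 1, 0] * g := by
  set N : Matrix (Fin 3) (Fin 3) K := !![0, a * r, a * q; q, 0, a * r; r, q, 0] with hN
  have hgN : g * N = N * g := by
    have h' := h
    rw [cubicMat_eq_smul_one_add, mul_add, add_mul, Matrix.mul_smul, Matrix.smul_mul, Matrix.mul_one, Matrix.one_mul] at h'
    exact add_left_cancel h'
  have hgN2 : g * (N * N) = N * N * g := by rw [← Matrix.mul_assoc, hgN, Matrix.mul_assoc, hgN, Matrix.mul_assoc]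
  have hD := cube_sub_mul_cube_ne_zero hcube hqr
  have key := smul_companion_eq a q r
  rw [← hN] at key
  apply smul_right_injective (Matrix (Fin 3) (Fin 3) K) hD
  simp only
  rw [← Matrix.mul_smul, ← Matrix.smul_mul, key]
  simp only [mul_add, add_mul, mul_sub, sub_mul, Matrix.mul_smul, Matrix.smul_mul, Matrix.mul_one, Matrix.one_mul, hgN, hgN2]

end Field

/-! ## §2 The cubic norm form reads the valuation (`v a = exp(−2)`): bounds for unitary torus elements -/

section Valued

variable {K : Type*} [Field K] [hK : Valued K (WithZero (Multiplicative ℤ))]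

/-- Two sums of a valuation: `v (x + y) = max (v x) (v y)` as soon as «`v x = v y` forces `x = 0`». [folklore] -/
private theorem v_add_eq_max {x y : K} (h : Valued.v x = Valued.v y → x = 0) : Valued.v (x + y) = max (Valued.v x) (Valued.v y) := by
  by_cases hxy : Valued.v x = Valued.v y
  · have hx : x = 0 := h hxy
    have hy : Valued.v y = 0 := by rw [← hxy, hx, map_zero]
    rw [hx, zero_add, map_zero, hy, max_self]
  · exact Valuation.map_add_of_distinct_val _ hxy

/-- `exp (log (v x)) = v x` for `x ≠ 0`. [folklore] -/
private theorem exp_log_v {x : K} (hx : x ≠ 0) : WithZero.exp (WithZero.log (Valued.v x)) = Valued.v x :=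
  WithZero.exp_log ((Valuation.ne_zero_iff _).2 hx)

/-- The three pure terms `p³`, `a q³`, `a² r³` of the cubic norm form have pairwise DISTINCT valuations unless they vanish (`v a = exp(−2)`: the orders are
`≡ 0, 1, 2 (mod 3)`). [cite: Rogawski1990, §3.6 p. 31] -/
theorem v_pure_terms_ne {a : K} (ha : Valued.v a = WithZero.exp (-2 : ℤ)) (p q r : K) :
    (Valued.v (p ^ 3) = Valued.v (a * q ^ 3) → p ^ 3 = 0) ∧ (Valued.v (p ^ 3) = Valued.v (a ^ 2 * r ^ 3) → p ^ 3 = 0) ∧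
      (Valued.v (a * q ^ 3) = Valued.v (a ^ 2 * r ^ 3) → a * q ^ 3 = 0) := by
  have ha0 : a ≠ 0 := fun h => by rw [h, map_zero] at ha; exact WithZero.exp_ne_zero ha.symm
  refine ⟨fun h => ?_, fun h => ?_, fun h => ?_⟩
  · by_contra hp3
    have hp : p ≠ 0 := fun hp => hp3 (by rw [hp]; ring)
    have hq : q ≠ 0 := by
      intro hq; rw [hq, zero_pow three_ne_zero, mul_zero, map_zero, map_pow] at h
      exact hp (by simpa using h)
    rw [map_pow, map_mul, map_pow, ha, ← exp_log_v hp, ← exp_log_v hq, ← WithZero.exp_nsmul, ← WithZero.exp_nsmul, ← WithZero.exp_add,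
      WithZero.exp_inj] at h
    simp only [nsmul_eq_mul, Nat.cast_ofNat] at h
    omega
  · by_contra hp3
    have hp : p ≠ 0 := fun hp => hp3 (by rw [hp]; ring)
    have hr : r ≠ 0 := by
      intro hr; rw [hr, zero_pow three_ne_zero, mul_zero, map_zero, map_pow] at h
      exact hp (by simpa using h)
    rw [map_pow, map_mul, map_pow, map_pow, ha, ← exp_log_v hp, ← exp_log_v hr, ← WithZero.exp_nsmul, ← WithZero.exp_nsmul,
      ← WithZero.exp_nsmul, ← WithZero.exp_add, WithZero.exp_inj] at h
    simp only [nsmul_eq_mul, Nat.cast_ofNat] at h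
    omega
  · by_contra hq3
    have hq : q ≠ 0 := fun hq => hq3 (by rw [hq]; ring)
    have hr : r ≠ 0 := by
      intro hr; rw [hr, zero_pow three_ne_zero, mul_zero, map_zero, map_mul, map_pow] at h
      exact hq (by simpa [ha0] using h)
    rw [map_mul, map_pow, map_mul, map_pow, map_pow, ha, ← exp_log_v hq, ← exp_log_v hr, ← WithZero.exp_nsmul, ← WithZero.exp_nsmul,
      ← WithZero.exp_nsmul, ← WithZero.exp_add, ← WithZero.exp_add, WithZero.exp_inj] at h
    simp only [nsmul_eq_mul, Nat.cast_ofNat] at h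
    omega

/-- **The cubic norm form reads the valuation**: for `v a = exp(−2)` and `v 3 ≤ 1`,
`v (p³ + a q³ + a² r³ − 3a·pqr) = max (v p³) (max (v (a q³)) (v (a² r³)))` — the pure terms have pairwise distinct orders (`≡ 0, 1, 2 mod 3`) and the
cross term is strictly deeper. [cite: Rogawski1990, §3.6 p. 31] -/
theorem v_det_cubicMat_eq_max {a : K} (ha : Valued.v a = WithZero.exp (-2 : ℤ)) (h3 : Valued.v (3 : K) ≤ 1) (p q r : K) :
    Valued.v (p ^ 3 + a * q ^ 3 + a ^ 2 * r ^ 3 - 3 * a * p * q * r) =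
      max (Valued.v (p ^ 3)) (max (Valued.v (a * q ^ 3)) (Valued.v (a ^ 2 * r ^ 3))) := by
  have ha0 : a ≠ 0 := fun h => by rw [h, map_zero] at ha; exact WithZero.exp_ne_zero ha.symm
  obtain ⟨h12, h13, h23⟩ := v_pure_terms_ne ha p q r
  -- the pure part
  have hS : Valued.v (p ^ 3 + a * q ^ 3 + a ^ 2 * r ^ 3) = max (Valued.v (p ^ 3)) (max (Valued.v (a * q ^ 3)) (Valued.v (a ^ 2 * r ^ 3))) := by
    have h1 : Valued.v (p ^ 3 + a * q ^ 3) = max (Valued.v (p ^ 3)) (Valued.v (a * q ^ 3)) := v_add_eq_max h12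
    have h2 : Valued.v (p ^ 3 + a * q ^ 3) = Valued.v (a ^ 2 * r ^ 3) → p ^ 3 + a * q ^ 3 = 0 := by
      intro h
      rw [h1] at h
      rcases le_total (Valued.v (a * q ^ 3)) (Valued.v (p ^ 3)) with hle | hle
      · rw [max_eq_left hle] at h
        have hp : p ^ 3 = 0 := h13 h
        rw [hp, map_zero] at hle
        have hq : a * q ^ 3 = 0 := (Valuation.zero_iff _).1 (le_antisymm hle zero_le)
        rw [hp, hq, add_zero]
      · rw [max_eq_right hle] at h
        have hq : a * q ^ 3 = 0 := h23 h
        rw [hq, map_zero] at hle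
        have hp : p ^ 3 = 0 := (Valuation.zero_iff _).1 (le_antisymm hle zero_le)
        rw [hp, hq, add_zero]
    rw [v_add_eq_max h2, h1, max_assoc]
  by_cases hX : 3 * a * p * q * r = 0
  · rw [hX, sub_zero, hS]
  · -- all of `p, q, r` are non-zero: compare exponents
    have hp : p ≠ 0 := fun h => hX (by rw [h]; ring)
    have hq : q ≠ 0 := fun h => hX (by rw [h]; ring)
    have hr : r ≠ 0 := fun h => hX (by rw [h]; ring)
    have h30 : (3 : K) ≠ 0 := fun h => hX (by rw [h]; ring)
    have hlt : Valued.v (3 * a * p * q * r) < Valued.v (p ^ 3 + a * q ^ 3 + a ^ 2 * r ^ 3) := by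
      rw [hS]
      set e := WithZero.log (Valued.v p) with he
      set f := WithZero.log (Valued.v q) with hf
      set g := WithZero.log (Valued.v r) with hg
      have hep : Valued.v p = WithZero.exp e := (exp_log_v hp).symm
      have hfq : Valued.v q = WithZero.exp f := (exp_log_v hq).symm
      have hgr : Valued.v r = WithZero.exp g := (exp_log_v hr).symm
      have hX' : Valued.v (3 * a * p * q * r) ≤ WithZero.exp (-2 + (e + (f + g))) := by
        have hx : Valued.v (3 * a * p * q * r) = Valued.v (3 : K) * WithZero.exp (-2 + (e + (f + g))) := by
          rw [map_mul, map_mul, map_mul, map_mul, ha, hep, hfq, hgr, WithZero.exp_add, WithZero.exp_add, WithZero.exp_add]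
          simp only [mul_assoc]
        rw [hx]
        calc Valued.v (3 : K) * WithZero.exp (-2 + (e + (f + g))) ≤ 1 * WithZero.exp (-2 + (e + (f + g))) := by gcongr
          _ = WithZero.exp (-2 + (e + (f + g))) := one_mul _
      have hA' : Valued.v (p ^ 3) = WithZero.exp (3 * e) := by
        rw [map_pow, hep, ← WithZero.exp_nsmul]; simp only [nsmul_eq_mul, Nat.cast_ofNat]
      have hB' : Valued.v (a * q ^ 3) = WithZero.exp (-2 + 3 * f) := by
        rw [map_mul, map_pow, ha, hfq, ← WithZero.exp_nsmul, ← WithZero.exp_add]; simp only [nsmul_eq_mul, Nat.cast_ofNat]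
      have hC' : Valued.v (a ^ 2 * r ^ 3) = WithZero.exp (2 * (-2 : ℤ) + 3 * g) := by
        rw [map_mul, map_pow, map_pow, ha, hgr, ← WithZero.exp_nsmul, ← WithZero.exp_nsmul, ← WithZero.exp_add]
        simp only [nsmul_eq_mul, Nat.cast_ofNat]
      have hdisj : -2 + (e + (f + g)) < 3 * e ∨ -2 + (e + (f + g)) < -2 + 3 * f ∨ -2 + (e + (f + g)) < 2 * (-2 : ℤ) + 3 * g := by omega
      refine lt_of_le_of_lt hX' ?_
      rcases hdisj with h | h | h
      · exact lt_of_lt_of_le (by rw [hA', WithZero.exp_lt_exp]; exact h) (le_max_left _ _)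
      · exact lt_of_lt_of_le (by rw [hB', WithZero.exp_lt_exp]; exact h) ((le_max_left _ _).trans (le_max_right _ _))
      · exact lt_of_lt_of_le (by rw [hC', WithZero.exp_lt_exp]; exact h) ((le_max_right _ _).trans (le_max_right _ _))
    rw [Valuation.map_sub_eq_of_lt_left _ hlt, hS]

/-- **BOUNDS FOR NORM-ONE ELEMENTS OF THE CUBIC TORUS**: if `v a = exp(−2)`, `v 3 ≤ 1` and `v (det M(p,q,r)) = 1` (★ `det_cubicMat`), then `v p ≤ 1`, `v q ≤ 1`,
`v r ≤ exp 1` — each pure term is `≤ 1`. [cite: Rogawski1990, §3.6 p. 31] [cite: PlatonovRapinchuk1994, §6.4 Prop. 6.15] -/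
theorem v_le_of_v_det_cubicMat_eq_one {a : K} (ha : Valued.v a = WithZero.exp (-2 : ℤ)) (h3 : Valued.v (3 : K) ≤ 1) {p q r : K}
    (hn : Valued.v (p ^ 3 + a * q ^ 3 + a ^ 2 * r ^ 3 - 3 * a * p * q * r) = 1) :
    Valued.v p ≤ 1 ∧ Valued.v q ≤ 1 ∧ Valued.v r ≤ WithZero.exp (1 : ℤ) := by
  rw [v_det_cubicMat_eq_max ha h3] at hn
  have hA : Valued.v (p ^ 3) ≤ 1 := hn ▸ le_max_left _ _
  have hB : Valued.v (a * q ^ 3) ≤ 1 := hn ▸ (le_max_left _ _).trans (le_max_right _ _)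
  have hC : Valued.v (a ^ 2 * r ^ 3) ≤ 1 := hn ▸ (le_max_right _ _).trans (le_max_right _ _)
  refine ⟨?_, ?_, ?_⟩
  · rcases eq_or_ne p 0 with rfl | hp
    · simp
    · rw [map_pow, ← exp_log_v hp, ← WithZero.exp_nsmul, ← WithZero.exp_zero, WithZero.exp_le_exp] at hA
      rw [← exp_log_v hp, ← WithZero.exp_zero, WithZero.exp_le_exp]
      simp only [nsmul_eq_mul, Nat.cast_ofNat] at hA
      omega
  · rcases eq_or_ne q 0 with rfl | hq
    · simp
    · rw [map_mul, map_pow, ha, ← exp_log_v hq, ← WithZero.exp_nsmul, ← WithZero.exp_add, ← WithZero.exp_zero, WithZero.exp_le_exp] at hB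
      rw [← exp_log_v hq, ← WithZero.exp_zero, WithZero.exp_le_exp]
      simp only [nsmul_eq_mul, Nat.cast_ofNat] at hB
      omega
  · rcases eq_or_ne r 0 with rfl | hr
    · simp
    · rw [map_mul, map_pow, map_pow, ha, ← exp_log_v hr, ← WithZero.exp_nsmul, ← WithZero.exp_nsmul, ← WithZero.exp_add, ← WithZero.exp_zero,
        WithZero.exp_le_exp] at hC
      rw [← exp_log_v hr, WithZero.exp_le_exp]
      simp only [nsmul_eq_mul, Nat.cast_ofNat] at hC
      omega

end Valued

/-! ## §3 CM, non-split place: the cubic torus is the centraliser of each of its regular elements, and it is compact -/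

section CM

variable (L : Type) [Field L] [NumberField L] [IsCMField L] {v : HeightOneSpectrum (𝓞 ↥(maximalRealSubfield L))}
  (w : PlacesOver L v) (hw : IsCMField.complexConj L • w.1 = w.1)

/-- A norm-one element of `L_w` has valuation one (`σ_w` preserves `v_w`). [cite: CasselsFrohlichANT1967, Ch. VII §1.1] -/
private theorem v_eq_one_of_mul_self {x : w.1.adicCompletion L}
    (hx : galAdicCompletionMap (L := L) (IsCMField.complexConj L) hw x * x = 1) : Valued.v x = 1 := by
  have h := congrArg Valued.v hx
  rw [map_mul, map_one, valued_galAdicCompletionMap] at h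
  rcases lt_trichotomy (Valued.v x) 1 with hlt | heq | hgt
  · exact absurd h (mul_lt_one' hlt hlt).ne
  · exact heq
  · exact absurd h (one_lt_mul'' hgt hgt).ne'

/-- **The unitary elements commuting with `C_a` form a COMPACT subset of the one-place model `U(σ_w, Φ₃)(L_w)`** when `σ_w a = a` and
`v_w a = exp(−2)`: they are the `M(p,q,r)` with `M(σp,σq,σr)·M(p,q,r) = 1` (★ `exists_eq_cubicMat_of_commute_of_form`), whence `|det M| = 1` and
`v p ≤ 1, v q ≤ 1, v r ≤ exp 1` (★ `v_le_of_v_det_cubicMat_eq_one`) — a continuous image of a closed subset of a product of three compact balls of `L_w`.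
[cite: PlatonovRapinchuk1994, §6.4 Prop. 6.15] [cite: Rogawski1990, §3.6 p. 31] -/
theorem isCompact_setOf_commute_companion {a : w.1.adicCompletion L} (hσa : (galAdicCompletionMap (L := L) (IsCMField.complexConj L) hw) a = a)
    (hva : Valued.v a = WithZero.exp (-2 : ℤ)) :
    IsCompact {u : ↥(unitaryGroupOfForm (galAdicCompletionMap (L := L) (IsCMField.complexConj L) hw) (placeForm (Rogawski1990.qsForm L) w.1)) |
      ((u : GL (Fin 3) (w.1.adicCompletion L)) : Matrix (Fin 3) (Fin 3) (w.1.adicCompletion L)) * !![(0 : (w.1.adicCompletion L)), 0, a; 1, 0, 0; 0, 1, 0] =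
        !![(0 : (w.1.adicCompletion L)), 0, a; 1, 0, 0; 0, 1, 0] * ((u : GL (Fin 3) (w.1.adicCompletion L)) : Matrix (Fin 3) (Fin 3) (w.1.adicCompletion L))} := by
  classical
  obtain ⟨ϖ, hϖ, -⟩ := exists_uniformizer L w hw
  haveI := compactSpace_integer_adicCompletion L w.1
  have hσc : Continuous (galAdicCompletionMap (L := L) (IsCMField.complexConj L) hw) := continuous_galAdicCompletionMap L (IsCMField.complexConj L) hw
  have h3 : Valued.v (3 : w.1.adicCompletion L) ≤ 1 := by
    have hcast : (3 : w.1.adicCompletion L) = algebraMap L (w.1.adicCompletion L) (algebraMap (𝓞 L) L (3 : 𝓞 L)) := by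
      rw [map_ofNat, map_ofNat]
    have hval : ∀ c : L, Valued.v (algebraMap L (w.1.adicCompletion L) c) = w.1.valuation L c :=
      fun c => HeightOneSpectrum.valuedAdicCompletion_eq_valuation' w.1 c
    rw [hcast, hval, HeightOneSpectrum.valuation_of_algebraMap]
    exact w.1.intValuation_le_one _
  -- the parameter map (continuous: a linear combination of `1, C, C²`)
  have hMc : Continuous (fun t : (w.1.adicCompletion L) × (w.1.adicCompletion L) × (w.1.adicCompletion L) =>
      (!![t.1, a * t.2.2, a * t.2.1; t.2.1, t.1, a * t.2.2; t.2.2, t.2.1, t.1] : Matrix (Fin 3) (Fin 3) (w.1.adicCompletion L))) := by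
    have hMeq : (fun t : (w.1.adicCompletion L) × (w.1.adicCompletion L) × (w.1.adicCompletion L) => (!![t.1, a * t.2.2, a * t.2.1; t.2.1, t.1, a * t.2.2; t.2.2, t.2.1, t.1] : Matrix (Fin 3) (Fin 3) (w.1.adicCompletion L))) =
        fun t => t.1 • (1 : Matrix (Fin 3) (Fin 3) (w.1.adicCompletion L)) + t.2.1 • !![(0 : (w.1.adicCompletion L)), 0, a; 1, 0, 0; 0, 1, 0] +
          t.2.2 • !![(0 : (w.1.adicCompletion L)), 0, a; 1, 0, 0; 0, 1, 0] ^ 2 := funext fun t => cubicMat_eq_smul_add a _ _ _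
    rw [hMeq]
    exact ((continuous_fst.smul continuous_const).add ((continuous_fst.comp continuous_snd).smul continuous_const)).add
      ((continuous_snd.comp continuous_snd).smul continuous_const)
  -- the compact parameter set: three balls, cut by the (closed) unitarity condition
  have hSc : IsCompact ((({x : (w.1.adicCompletion L) | Valued.v x ≤ WithZero.exp (0 : ℤ)} ×ˢ ({x : (w.1.adicCompletion L) | Valued.v x ≤ WithZero.exp (0 : ℤ)} ×ˢ
      {x : (w.1.adicCompletion L) | Valued.v x ≤ WithZero.exp (1 : ℤ)})) ∩
      {t : (w.1.adicCompletion L) × (w.1.adicCompletion L) × (w.1.adicCompletion L) | ((!![t.1, a * t.2.2, a * t.2.1; t.2.1, t.1, a * t.2.2; t.2.2, t.2.1, t.1] : Matrix (Fin 3) (Fin 3) (w.1.adicCompletion L)).map (galAdicCompletionMap (L := L) (IsCMField.complexConj L) hw))ᵀ *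
          !![(0 : (w.1.adicCompletion L)), 0, 1; 0, 1, 0; 1, 0, 0] * !![t.1, a * t.2.2, a * t.2.1; t.2.1, t.1, a * t.2.2; t.2.2, t.2.1, t.1] =
        !![(0 : (w.1.adicCompletion L)), 0, 1; 0, 1, 0; 1, 0, 0]})) := by
    refine ((HermitianLattice.isCompact_setOf_v_le_exp_int hϖ 0).prod
      ((HermitianLattice.isCompact_setOf_v_le_exp_int hϖ 0).prod (HermitianLattice.isCompact_setOf_v_le_exp_int hϖ 1))).inter_right ?_
    exact isClosed_eq (((hMc.matrix_map hσc).matrix_transpose.matrix_mul continuous_const).matrix_mul hMc) continuous_const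
  -- on it, `M(p,q,r)` is a unit with inverse `M(σp,σq,σr)`, continuously
  obtain ⟨S, hS⟩ : ∃ S : Set ((w.1.adicCompletion L) × (w.1.adicCompletion L) × (w.1.adicCompletion L)), S = (({x : (w.1.adicCompletion L) | Valued.v x ≤ WithZero.exp (0 : ℤ)} ×ˢ ({x : (w.1.adicCompletion L) | Valued.v x ≤ WithZero.exp (0 : ℤ)} ×ˢ
      {x : (w.1.adicCompletion L) | Valued.v x ≤ WithZero.exp (1 : ℤ)})) ∩
      {t : (w.1.adicCompletion L) × (w.1.adicCompletion L) × (w.1.adicCompletion L) | ((!![t.1, a * t.2.2, a * t.2.1; t.2.1, t.1, a * t.2.2; t.2.2, t.2.1, t.1] : Matrix (Fin 3) (Fin 3) (w.1.adicCompletion L)).map (galAdicCompletionMap (L := L) (IsCMField.complexConj L) hw))ᵀ *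
          !![(0 : (w.1.adicCompletion L)), 0, 1; 0, 1, 0; 1, 0, 0] * !![t.1, a * t.2.2, a * t.2.1; t.2.1, t.1, a * t.2.2; t.2.2, t.2.1, t.1] =
        !![(0 : (w.1.adicCompletion L)), 0, 1; 0, 1, 0; 1, 0, 0]}) := ⟨_, rfl⟩
  rw [← hS] at hSc
  haveI : CompactSpace S := isCompact_iff_compactSpace.1 hSc
  have hmemS : ∀ t : S, ((!![t.1.1, a * t.1.2.2, a * t.1.2.1; t.1.2.1, t.1.1, a * t.1.2.2; t.1.2.2, t.1.2.1, t.1.1] : Matrix (Fin 3) (Fin 3) (w.1.adicCompletion L)).map (galAdicCompletionMap (L := L) (IsCMField.complexConj L) hw))ᵀ *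
        !![(0 : (w.1.adicCompletion L)), 0, 1; 0, 1, 0; 1, 0, 0] * !![t.1.1, a * t.1.2.2, a * t.1.2.1; t.1.2.1, t.1.1, a * t.1.2.2; t.1.2.2, t.1.2.1, t.1.1] =
      !![(0 : (w.1.adicCompletion L)), 0, 1; 0, 1, 0; 1, 0, 0] := fun t => by
    have h : (t : (w.1.adicCompletion L) × (w.1.adicCompletion L) × (w.1.adicCompletion L)) ∈ _ :=
      (congrArg (fun X : Set ((w.1.adicCompletion L) × (w.1.adicCompletion L) × (w.1.adicCompletion L)) =>
        ((t : (w.1.adicCompletion L) × (w.1.adicCompletion L) × (w.1.adicCompletion L)) ∈ X)) hS).mp t.2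
    exact h.2
  have hNM : ∀ t : S, !![(galAdicCompletionMap (L := L) (IsCMField.complexConj L) hw) t.1.1, a * (galAdicCompletionMap (L := L) (IsCMField.complexConj L) hw) t.1.2.2, a * (galAdicCompletionMap (L := L) (IsCMField.complexConj L) hw) t.1.2.1; (galAdicCompletionMap (L := L) (IsCMField.complexConj L) hw) t.1.2.1, (galAdicCompletionMap (L := L) (IsCMField.complexConj L) hw) t.1.1, a * (galAdicCompletionMap (L := L) (IsCMField.complexConj L) hw) t.1.2.2;
        (galAdicCompletionMap (L := L) (IsCMField.complexConj L) hw) t.1.2.2, (galAdicCompletionMap (L := L) (IsCMField.complexConj L) hw) t.1.2.1, (galAdicCompletionMap (L := L) (IsCMField.complexConj L) hw) t.1.1] *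
      !![t.1.1, a * t.1.2.2, a * t.1.2.1; t.1.2.1, t.1.1, a * t.1.2.2; t.1.2.2, t.1.2.1, t.1.1] = 1 := fun t =>
    (form_cubicMat_eq_iff (galAdicCompletionMap (L := L) (IsCMField.complexConj L) hw) hσa _ _ _).mp (hmemS t)
  have hMN : ∀ t : S, !![t.1.1, a * t.1.2.2, a * t.1.2.1; t.1.2.1, t.1.1, a * t.1.2.2; t.1.2.2, t.1.2.1, t.1.1] *
      !![(galAdicCompletionMap (L := L) (IsCMField.complexConj L) hw) t.1.1, a * (galAdicCompletionMap (L := L) (IsCMField.complexConj L) hw) t.1.2.2, a * (galAdicCompletionMap (L := L) (IsCMField.complexConj L) hw) t.1.2.1; (galAdicCompletionMap (L := L) (IsCMField.complexConj L) hw) t.1.2.1, (galAdicCompletionMap (L := L) (IsCMField.complexConj L) hw) t.1.1, a * (galAdicCompletionMap (L := L) (IsCMField.complexConj L) hw) t.1.2.2;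
        (galAdicCompletionMap (L := L) (IsCMField.complexConj L) hw) t.1.2.2, (galAdicCompletionMap (L := L) (IsCMField.complexConj L) hw) t.1.2.1, (galAdicCompletionMap (L := L) (IsCMField.complexConj L) hw) t.1.1] = 1 := fun t =>
    (cubicMat_comm a _ _ _ _ _ _).trans (hNM t)
  have hφc : Continuous (fun t : S => (⟨⟨_, _, hMN t, hNM t⟩, (mem_unitaryGroupOfForm_iff (σ := (galAdicCompletionMap (L := L) (IsCMField.complexConj L) hw)) (J := placeForm (Rogawski1990.qsForm L) w.1)).2 (by
      rw [placeForm_qsForm_eq L w]; exact hmemS t)⟩ : ↥(unitaryGroupOfForm (galAdicCompletionMap (L := L) (IsCMField.complexConj L) hw) (placeForm (Rogawski1990.qsForm L) w.1)))) := by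
    refine (Units.continuous_iff.2 ⟨?_, ?_⟩).subtype_mk _
    · exact hMc.comp continuous_subtype_val
    · show Continuous (fun t : S => (!![(galAdicCompletionMap (L := L) (IsCMField.complexConj L) hw) t.1.1, a * (galAdicCompletionMap (L := L) (IsCMField.complexConj L) hw) t.1.2.2, a * (galAdicCompletionMap (L := L) (IsCMField.complexConj L) hw) t.1.2.1; (galAdicCompletionMap (L := L) (IsCMField.complexConj L) hw) t.1.2.1, (galAdicCompletionMap (L := L) (IsCMField.complexConj L) hw) t.1.1, a * (galAdicCompletionMap (L := L) (IsCMField.complexConj L) hw) t.1.2.2;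
        (galAdicCompletionMap (L := L) (IsCMField.complexConj L) hw) t.1.2.2, (galAdicCompletionMap (L := L) (IsCMField.complexConj L) hw) t.1.2.1, (galAdicCompletionMap (L := L) (IsCMField.complexConj L) hw) t.1.1] : Matrix (Fin 3) (Fin 3) (w.1.adicCompletion L)))
      have h : Continuous (fun t : S => ((!![t.1.1, a * t.1.2.2, a * t.1.2.1; t.1.2.1, t.1.1, a * t.1.2.2; t.1.2.2, t.1.2.1, t.1.1] :
          Matrix (Fin 3) (Fin 3) (w.1.adicCompletion L)).map (galAdicCompletionMap (L := L) (IsCMField.complexConj L) hw))) := (hMc.comp continuous_subtype_val).matrix_map hσc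
      refine h.congr fun t => ?_
      rw [map_cubicMat, hσa]
  -- the range is the set in question
  refine (isCompact_range hφc).of_isClosed_subset ?_ ?_
  · exact isClosed_eq ((Units.continuous_val.comp continuous_subtype_val).matrix_mul continuous_const)
      (continuous_const.matrix_mul (Units.continuous_val.comp continuous_subtype_val))
  · intro u hu
    have huU : ((((u : GL (Fin 3) (w.1.adicCompletion L)) : Matrix (Fin 3) (Fin 3) (w.1.adicCompletion L))).map (galAdicCompletionMap (L := L) (IsCMField.complexConj L) hw))ᵀ * !![(0 : (w.1.adicCompletion L)), 0, 1; 0, 1, 0; 1, 0, 0] *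
        ((u : GL (Fin 3) (w.1.adicCompletion L)) : Matrix (Fin 3) (Fin 3) (w.1.adicCompletion L)) = !![(0 : (w.1.adicCompletion L)), 0, 1; 0, 1, 0; 1, 0, 0] := by
      rw [← placeForm_qsForm_eq L w]; exact u.2
    obtain ⟨p, q, r, hupqr, hnorm⟩ := exists_eq_cubicMat_of_commute_of_form (galAdicCompletionMap (L := L) (IsCMField.complexConj L) hw) hσa _ hu huU
    have hdet : Valued.v (p ^ 3 + a * q ^ 3 + a ^ 2 * r ^ 3 - 3 * a * p * q * r) = 1 := by
      apply v_eq_one_of_mul_self L w hw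
      have h := congrArg Matrix.det hnorm
      rw [Matrix.det_mul, Matrix.det_one, det_cubicMat, det_cubicMat] at h
      have hσN : (galAdicCompletionMap (L := L) (IsCMField.complexConj L) hw) (p ^ 3 + a * q ^ 3 + a ^ 2 * r ^ 3 - 3 * a * p * q * r) =
          (galAdicCompletionMap (L := L) (IsCMField.complexConj L) hw) p ^ 3 + a * (galAdicCompletionMap (L := L) (IsCMField.complexConj L) hw) q ^ 3 + a ^ 2 * (galAdicCompletionMap (L := L) (IsCMField.complexConj L) hw) r ^ 3 - 3 * a * (galAdicCompletionMap (L := L) (IsCMField.complexConj L) hw) p * (galAdicCompletionMap (L := L) (IsCMField.complexConj L) hw) q * (galAdicCompletionMap (L := L) (IsCMField.complexConj L) hw) r := by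
        simp only [map_add, map_sub, map_mul, map_pow, hσa, map_ofNat]
      rw [hσN]
      exact h
    obtain ⟨hp, hq, hr⟩ := v_le_of_v_det_cubicMat_eq_one hva h3 hdet
    have ht : (p, q, r) ∈ S := by
      rw [hS]
      refine ⟨⟨by simpa using hp, by simpa using hq, hr⟩, ?_⟩
      show ((!![p, a * r, a * q; q, p, a * r; r, q, p] : Matrix (Fin 3) (Fin 3) (w.1.adicCompletion L)).map _)ᵀ * _ * _ = _
      rw [← hupqr]; exact huU
    refine ⟨⟨(p, q, r), ht⟩, ?_⟩
    apply Subtype.ext; apply Units.ext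
    exact hupqr.symm

set_option maxHeartbeats 400000 in
/-- **HEAD. THE CUBIC TORUS IS AN ELLIPTIC CARTAN SUBGROUP OF `U(Φ₃)(L⁺_v)`** ([Rogawski1990] §3.6, type (3); [PlatonovRapinchuk1994] §6.4): with
`a = ϖ·σ_w ϖ` and `T` the torus of ★ `exists_typeThree_cartan_of_elt` (clauses (i)–(v) of ★ FILE B repeated), moreover
(vi) **`Z_{U(Φ₃)(L⁺_v)}(γ) = T` for every REGULAR `γ ∈ T`** (★ `commute_companion_of_commute_cubicMat`: `T` is a Cartan subgroup, the centraliser of each of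
its regular elements), and (vii) **`T` is COMPACT** (its one-place image is `{M(p,q,r) unitary}` with `v p ≤ 1, v q ≤ 1, v r ≤ exp 1` by ★
`v_le_of_v_det_cubicMat_eq_one` — a continuous image of a compact subset of `L_w³`).  Carrier `↥(UnitaryGroup.«local» L c 3 Φ₃ v) = Gqs L v` (★ `cmDatum_Local`).
[cite: Rogawski1990, §3.6 p. 31; §3.1 p. 19; §12.5 p. 184] [cite: PlatonovRapinchuk1994, §6.4 Prop. 6.15] -/
theorem exists_typeThree_cartan_elliptic :
    ∃ (a : w.1.adicCompletion L) (T : Subgroup ↥(«local» L (IsCMField.complexConj L) 3 (Rogawski1990.qsForm L) v)),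
      galAdicCompletionMap (L := L) (IsCMField.complexConj L) hw a = a ∧ a ≠ 0 ∧ (∀ b : w.1.adicCompletion L, b ^ 3 ≠ a) ∧
      (∀ γ : ↥(«local» L (IsCMField.complexConj L) 3 (Rogawski1990.qsForm L) v), γ ∈ T ↔
        (((localNonsplitEquiv (IsCMField.complexConj L) (Rogawski1990.qsForm L) (IsCMField.complexConj_ne_one L) w hw γ : ↥(unitaryGroupOfForm (galAdicCompletionMap (L := L) (IsCMField.complexConj L) hw) (placeForm (Rogawski1990.qsForm L) w.1))) :
            GL (Fin 3) (w.1.adicCompletion L)) : Matrix (Fin 3) (Fin 3) (w.1.adicCompletion L)) * !![(0 : w.1.adicCompletion L), 0, a; 1, 0, 0; 0, 1, 0] =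
          !![(0 : w.1.adicCompletion L), 0, a; 1, 0, 0; 0, 1, 0] * (((localNonsplitEquiv (IsCMField.complexConj L) (Rogawski1990.qsForm L) (IsCMField.complexConj_ne_one L) w hw γ : ↥(unitaryGroupOfForm (galAdicCompletionMap (L := L) (IsCMField.complexConj L) hw) (placeForm (Rogawski1990.qsForm L) w.1))) :
            GL (Fin 3) (w.1.adicCompletion L)) : Matrix (Fin 3) (Fin 3) (w.1.adicCompletion L))) ∧
      (∀ γ ∈ T, ∀ γ' ∈ T, γ * γ' = γ' * γ) ∧
      (∀ γ ∈ T, IsRegularElt (γ : GL (Fin 3) (LocalRing L v)) → ∀ μ : LocalRing L v, ¬ (((γ : GL (Fin 3) (LocalRing L v)) : Matrix (Fin 3) (Fin 3) (LocalRing L v)).charpoly).IsRoot μ) ∧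
      (∀ γ ∈ T, ¬ IsRegularElt (γ : GL (Fin 3) (LocalRing L v)) →
        ∃ z : w.1.adicCompletion L, (((localNonsplitEquiv (IsCMField.complexConj L) (Rogawski1990.qsForm L) (IsCMField.complexConj_ne_one L) w hw γ : ↥(unitaryGroupOfForm (galAdicCompletionMap (L := L) (IsCMField.complexConj L) hw) (placeForm (Rogawski1990.qsForm L) w.1))) :
            GL (Fin 3) (w.1.adicCompletion L)) : Matrix (Fin 3) (Fin 3) (w.1.adicCompletion L)) = z • (1 : Matrix (Fin 3) (Fin 3) (w.1.adicCompletion L))) ∧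
      (∀ U ∈ 𝓝 (1 : ↥(«local» L (IsCMField.complexConj L) 3 (Rogawski1990.qsForm L) v)), ∃ γ ∈ T, γ ∈ U ∧ IsRegularElt (γ : GL (Fin 3) (LocalRing L v))) ∧
      (∀ γ ∈ T, IsRegularElt (γ : GL (Fin 3) (LocalRing L v)) → Subgroup.centralizer ({γ} : Set ↥(«local» L (IsCMField.complexConj L) 3 (Rogawski1990.qsForm L) v)) = T) ∧
      IsCompact (T : Set ↥(«local» L (IsCMField.complexConj L) 3 (Rogawski1990.qsForm L) v)) := by
  classical
  -- the element `a = ϖ σϖ`: fixed, non-zero, `v a = exp(−2) < 1`, not a cube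
  obtain ⟨ϖ, hϖ, hσϖ⟩ := exists_uniformizer L w hw
  set a : w.1.adicCompletion L := ϖ * (galAdicCompletionMap (L := L) (IsCMField.complexConj L) hw) ϖ with ha_def
  have hva : Valued.v a = WithZero.exp (-2 : ℤ) := by
    rw [ha_def, map_mul, hϖ, hσϖ, ← WithZero.exp_add]; norm_num
  have ha0 : a ≠ 0 := fun h => by rw [h, map_zero] at hva; exact WithZero.exp_ne_zero hva.symm
  have hσa : (galAdicCompletionMap (L := L) (IsCMField.complexConj L) hw) a = a := by rw [ha_def, map_mul, galAdicCompletionMap_cm_involutive, mul_comm]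
  have ha1 : Valued.v a < 1 := by rw [hva, ← WithZero.exp_zero, WithZero.exp_lt_exp]; norm_num
  have hcube : ∀ b : w.1.adicCompletion L, b ^ 3 ≠ a := by
    intro b hb
    have h := congrArg (fun x => WithZero.log (Valued.v x)) hb
    simp only [map_pow, hva, WithZero.log_pow, WithZero.log_exp, nsmul_eq_mul, Nat.cast_ofNat] at h
    omega
  have hirr : Irreducible (X ^ 3 - Polynomial.C a : (w.1.adicCompletion L)[X]) := irreducible_X_pow_three_sub_C hcube
  have h3 : Valued.v (3 : w.1.adicCompletion L) ≤ 1 := by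
    have hcast : (3 : w.1.adicCompletion L) = algebraMap L (w.1.adicCompletion L) (algebraMap (𝓞 L) L (3 : 𝓞 L)) := by
      rw [map_ofNat, map_ofNat]
    have hval : ∀ c : L, Valued.v (algebraMap L (w.1.adicCompletion L) c) = w.1.valuation L c :=
      fun c => HeightOneSpectrum.valuedAdicCompletion_eq_valuation' w.1 c
    rw [hcast, hval, HeightOneSpectrum.valuation_of_algebraMap]
    exact w.1.intValuation_le_one _
  -- the torus of FILE B at this `a`
  set e := localNonsplitEquiv (IsCMField.complexConj L) (Rogawski1990.qsForm L) (IsCMField.complexConj_ne_one L) w hw with he_def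
  obtain ⟨T, hmem, hab, hroot, hscal, hacc⟩ := exists_typeThree_cartan_of_elt L w hw a hσa ha0 ha1 hcube
  -- the one-place image of a torus element is an explicit unitary `M(p,q,r)`
  have hform : ∀ γ : ↥(«local» L (IsCMField.complexConj L) 3 (Rogawski1990.qsForm L) v),
      ((((e γ : ↥(unitaryGroupOfForm (galAdicCompletionMap (L := L) (IsCMField.complexConj L) hw) (placeForm (Rogawski1990.qsForm L) w.1))) : GL (Fin 3) (w.1.adicCompletion L)) : Matrix (Fin 3) (Fin 3) (w.1.adicCompletion L)).map (galAdicCompletionMap (L := L) (IsCMField.complexConj L) hw))ᵀ *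
          !![(0 : w.1.adicCompletion L), 0, 1; 0, 1, 0; 1, 0, 0] *
        (((e γ : ↥(unitaryGroupOfForm (galAdicCompletionMap (L := L) (IsCMField.complexConj L) hw) (placeForm (Rogawski1990.qsForm L) w.1))) : GL (Fin 3) (w.1.adicCompletion L)) : Matrix (Fin 3) (Fin 3) (w.1.adicCompletion L)) =
        !![(0 : w.1.adicCompletion L), 0, 1; 0, 1, 0; 1, 0, 0] := fun γ => by
    rw [← placeForm_qsForm_eq L w]
    exact (e γ).2
  refine ⟨a, T, hσa, ha0, hcube, hmem, hab, hroot, hscal, hacc, ?_, ?_⟩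
  · -- (vi) the Cartan property
    intro γ hγ hreg
    have hγC := (hmem γ).mp hγ
    have hγM := (commute_companion_iff a _).mp hγC
    have hsep := (isRegularElt_iff_separable_localNonsplitEquiv L w hw γ).mp hreg
    rw [← he_def] at hsep
    rw [hγM] at hsep
    have hqr := (separable_charpoly_cubicMat_iff hirr _ _ _).mp hsep
    ext x
    rw [Subgroup.mem_centralizer_singleton_iff]
    constructor
    · intro hx
      rw [hmem]
      have hxγ : (((e x : ↥(unitaryGroupOfForm (galAdicCompletionMap (L := L) (IsCMField.complexConj L) hw) (placeForm (Rogawski1990.qsForm L) w.1))) : GL (Fin 3) (w.1.adicCompletion L)) : Matrix (Fin 3) (Fin 3) (w.1.adicCompletion L)) *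
          (((e γ : ↥(unitaryGroupOfForm (galAdicCompletionMap (L := L) (IsCMField.complexConj L) hw) (placeForm (Rogawski1990.qsForm L) w.1))) : GL (Fin 3) (w.1.adicCompletion L)) : Matrix (Fin 3) (Fin 3) (w.1.adicCompletion L)) =
          (((e γ : ↥(unitaryGroupOfForm (galAdicCompletionMap (L := L) (IsCMField.complexConj L) hw) (placeForm (Rogawski1990.qsForm L) w.1))) : GL (Fin 3) (w.1.adicCompletion L)) : Matrix (Fin 3) (Fin 3) (w.1.adicCompletion L)) *
          (((e x : ↥(unitaryGroupOfForm (galAdicCompletionMap (L := L) (IsCMField.complexConj L) hw) (placeForm (Rogawski1990.qsForm L) w.1))) : GL (Fin 3) (w.1.adicCompletion L)) : Matrix (Fin 3) (Fin 3) (w.1.adicCompletion L)) := by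
        have h0 := congrArg e hx
        rw [map_mul, map_mul] at h0
        have h1 := congrArg (fun u : ↥(unitaryGroupOfForm (galAdicCompletionMap (L := L) (IsCMField.complexConj L) hw) (placeForm (Rogawski1990.qsForm L) w.1)) => ((u : GL (Fin 3) (w.1.adicCompletion L)) : Matrix (Fin 3) (Fin 3) (w.1.adicCompletion L))) h0
        simpa only [Subgroup.coe_mul, Units.val_mul] using h1
      rw [hγM] at hxγ
      exact commute_companion_of_commute_cubicMat hcube hqr _ hxγ
    · intro hx
      exact hab x hx γ hγ
  · -- (vii) compactness: `T = e⁻¹' (unitary elements commuting with C)`, a homeomorphic image of the compact set of `isCompact_setOf_commute_companion`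
    have hT : (T : Set ↥(«local» L (IsCMField.complexConj L) 3 (Rogawski1990.qsForm L) v)) = (fun u => e.symm u) '' {u : ↥(unitaryGroupOfForm (galAdicCompletionMap (L := L) (IsCMField.complexConj L) hw) (placeForm (Rogawski1990.qsForm L) w.1)) |
        ((u : GL (Fin 3) (w.1.adicCompletion L)) : Matrix (Fin 3) (Fin 3) (w.1.adicCompletion L)) * !![(0 : (w.1.adicCompletion L)), 0, a; 1, 0, 0; 0, 1, 0] =
          !![(0 : (w.1.adicCompletion L)), 0, a; 1, 0, 0; 0, 1, 0] * ((u : GL (Fin 3) (w.1.adicCompletion L)) : Matrix (Fin 3) (Fin 3) (w.1.adicCompletion L))} := by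
      ext γ
      simp only [SetLike.mem_coe, Set.mem_image, Set.mem_setOf_eq]
      constructor
      · intro hγ
        exact ⟨e γ, (hmem γ).mp hγ, e.symm_apply_apply γ⟩
      · rintro ⟨u, hu, rfl⟩
        rw [hmem, ContinuousMulEquiv.apply_symm_apply]
        exact hu
    rw [hT]
    exact (isCompact_setOf_commute_companion L w hw hσa hva).image e.symm.continuous

/-- **The elliptic-Cartan export on the organ's carrier `Gqs L v`** (★ `cmDatum_Local` is `rfl`): a subgroup `T ≤ Gqs L v` which is ABELIAN, whose REGULAR
elements have root-free characteristic polynomials (hence the (T3) second conjunct of `stub_EllipticPackage` for every `z ∈ U(1)(L⁺_v)`), whose regular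
elements ACCUMULATE at `1`, which is the CENTRALISER of each of its regular elements, and which is COMPACT. [cite: Rogawski1990, §3.6 p. 31; §12.7 p. 194]
[cite: PlatonovRapinchuk1994, §6.4 Prop. 6.15] -/
theorem exists_typeThree_cartan_elliptic_gqs (v : HeightOneSpectrum (𝓞 ↥(maximalRealSubfield L)))
    (hns : ∀ w : PlacesOver L v, IsCMField.complexConj L • w.1 = w.1) :
    ∃ T : Subgroup (Gqs L v),
      (∀ γ ∈ T, ∀ γ' ∈ T, γ * γ' = γ' * γ) ∧
      (∀ γ ∈ T, IsRegularElt (γ.val : GL (Fin 3) (LocalRing L v)) →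
        ∀ μ : LocalRing L v, ¬ ((((γ.val : GL (Fin 3) (LocalRing L v)) : Matrix (Fin 3) (Fin 3) (LocalRing L v))).charpoly).IsRoot μ) ∧
      (∀ γ ∈ T, IsRegularElt (γ.val : GL (Fin 3) (LocalRing L v)) →
        ∀ z : (UnitaryGroup.cmDatum L 1 (Matrix.of fun i j : Fin 1 => if i.val + j.val + 1 = 1 then (1 : L) else 0)).Local v,
          ¬ ((((γ.val : GL (Fin 3) (LocalRing L v)) : Matrix (Fin 3) (Fin 3) (LocalRing L v))).charpoly).IsRoot
            ((((z.val : GL (Fin 1) (LocalRing L v)) : Matrix (Fin 1) (Fin 1) (LocalRing L v))) 0 0)) ∧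
      (∀ U ∈ 𝓝 (1 : Gqs L v), ∃ γ ∈ T, γ ∈ U ∧ IsRegularElt (γ.val : GL (Fin 3) (LocalRing L v))) ∧
      (∀ γ ∈ T, IsRegularElt (γ.val : GL (Fin 3) (LocalRing L v)) → Subgroup.centralizer ({γ} : Set (Gqs L v)) = T) ∧
      IsCompact (T : Set (Gqs L v)) := by
  obtain ⟨w⟩ := (inferInstance : Nonempty (PlacesOver L v))
  obtain ⟨a, T, -, -, -, -, hab, hroot, -, hacc, hcart, hcpt⟩ := exists_typeThree_cartan_elliptic L w (hns w)
  exact ⟨T, hab, hroot, fun γ hγ hreg z => hroot γ hγ hreg _, hacc, hcart, hcpt⟩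

end CM

/-! ## §4 The norm-form valuation identity for ANY non-cube order `v a = exp k`, `3 ∤ k` (covers the imaginary Kummer parameter `a = −c₀` of the
★ «CAYLEY ∕ T3» family `Theorems/F0P3cStCharTSTypeThree*`, where `3 ∤ ord_w c₀`) -/

section ValuedGeneral

variable {K : Type*} [Field K] [hK : Valued K (WithZero (Multiplicative ℤ))]

/-- `exp (log (v x)) = v x` for `x ≠ 0` (restated for this section). [folklore] -/
private theorem exp_log_v' {x : K} (hx : x ≠ 0) : WithZero.exp (WithZero.log (Valued.v x)) = Valued.v x :=
  WithZero.exp_log ((Valuation.ne_zero_iff _).2 hx)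

/-- Two sums of a valuation (restated for this section): `v (x + y) = max (v x) (v y)` as soon as «`v x = v y` forces `x = 0`». [folklore] -/
private theorem v_add_eq_max' {x y : K} (h : Valued.v x = Valued.v y → x = 0) : Valued.v (x + y) = max (Valued.v x) (Valued.v y) := by
  by_cases hxy : Valued.v x = Valued.v y
  · have hx : x = 0 := h hxy
    have hy : Valued.v y = 0 := by rw [← hxy, hx, map_zero]
    rw [hx, zero_add, map_zero, hy, max_self]
  · exact Valuation.map_add_of_distinct_val _ hxy

/-- The three pure terms `p³`, `a q³`, `a² r³` have pairwise DISTINCT valuations unless they vanish, for ANY `a` of order `k` prime to `3`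
(`v a = exp k`, `3 ∤ k`: the orders are `≡ 0, k, 2k (mod 3)`, pairwise incongruent). [cite: Rogawski1990, §3.6 p. 31] -/
theorem v_pure_terms_ne_of_not_dvd {a : K} {k : ℤ} (ha : Valued.v a = WithZero.exp k) (hk : ¬ (3 : ℤ) ∣ k) (p q r : K) :
    (Valued.v (p ^ 3) = Valued.v (a * q ^ 3) → p ^ 3 = 0) ∧ (Valued.v (p ^ 3) = Valued.v (a ^ 2 * r ^ 3) → p ^ 3 = 0) ∧
      (Valued.v (a * q ^ 3) = Valued.v (a ^ 2 * r ^ 3) → a * q ^ 3 = 0) := by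
  have ha0 : a ≠ 0 := fun h => by rw [h, map_zero] at ha; exact WithZero.exp_ne_zero ha.symm
  refine ⟨fun h => ?_, fun h => ?_, fun h => ?_⟩
  · by_contra hp3
    have hp : p ≠ 0 := fun hp => hp3 (by rw [hp]; ring)
    have hq : q ≠ 0 := by
      intro hq; rw [hq, zero_pow three_ne_zero, mul_zero, map_zero, map_pow] at h
      exact hp (by simpa using h)
    rw [map_pow, map_mul, map_pow, ha, ← exp_log_v' hp, ← exp_log_v' hq, ← WithZero.exp_nsmul, ← WithZero.exp_nsmul, ← WithZero.exp_add,
      WithZero.exp_inj] at h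
    simp only [nsmul_eq_mul, Nat.cast_ofNat] at h
    omega
  · by_contra hp3
    have hp : p ≠ 0 := fun hp => hp3 (by rw [hp]; ring)
    have hr : r ≠ 0 := by
      intro hr; rw [hr, zero_pow three_ne_zero, mul_zero, map_zero, map_pow] at h
      exact hp (by simpa using h)
    rw [map_pow, map_mul, map_pow, map_pow, ha, ← exp_log_v' hp, ← exp_log_v' hr, ← WithZero.exp_nsmul, ← WithZero.exp_nsmul,
      ← WithZero.exp_nsmul, ← WithZero.exp_add, WithZero.exp_inj] at h
    simp only [nsmul_eq_mul, Nat.cast_ofNat] at h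
    omega
  · by_contra hq3
    have hq : q ≠ 0 := fun hq => hq3 (by rw [hq]; ring)
    have hr : r ≠ 0 := by
      intro hr; rw [hr, zero_pow three_ne_zero, mul_zero, map_zero, map_mul, map_pow] at h
      exact hq (by simpa [ha0] using h)
    rw [map_mul, map_pow, map_mul, map_pow, map_pow, ha, ← exp_log_v' hq, ← exp_log_v' hr, ← WithZero.exp_nsmul, ← WithZero.exp_nsmul,
      ← WithZero.exp_nsmul, ← WithZero.exp_add, ← WithZero.exp_add, WithZero.exp_inj] at h
    simp only [nsmul_eq_mul, Nat.cast_ofNat] at h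
    omega

/-- **The cubic norm form reads the valuation, general non-cube order**: for `v a = exp k` with `3 ∤ k` and `v 3 ≤ 1`,
`v (p³ + a q³ + a² r³ − 3a·pqr) = max (v p³) (max (v (a q³)) (v (a² r³)))`. [cite: Rogawski1990, §3.6 p. 31] -/
theorem v_det_cubicMat_eq_max_of_not_dvd {a : K} {k : ℤ} (ha : Valued.v a = WithZero.exp k) (hk : ¬ (3 : ℤ) ∣ k)
    (h3 : Valued.v (3 : K) ≤ 1) (p q r : K) :
    Valued.v (p ^ 3 + a * q ^ 3 + a ^ 2 * r ^ 3 - 3 * a * p * q * r) =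
      max (Valued.v (p ^ 3)) (max (Valued.v (a * q ^ 3)) (Valued.v (a ^ 2 * r ^ 3))) := by
  obtain ⟨h12, h13, h23⟩ := v_pure_terms_ne_of_not_dvd ha hk p q r
  have hS : Valued.v (p ^ 3 + a * q ^ 3 + a ^ 2 * r ^ 3) = max (Valued.v (p ^ 3)) (max (Valued.v (a * q ^ 3)) (Valued.v (a ^ 2 * r ^ 3))) := by
    have h1 : Valued.v (p ^ 3 + a * q ^ 3) = max (Valued.v (p ^ 3)) (Valued.v (a * q ^ 3)) := v_add_eq_max' h12
    have h2 : Valued.v (p ^ 3 + a * q ^ 3) = Valued.v (a ^ 2 * r ^ 3) → p ^ 3 + a * q ^ 3 = 0 := by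
      intro h
      rw [h1] at h
      rcases le_total (Valued.v (a * q ^ 3)) (Valued.v (p ^ 3)) with hle | hle
      · rw [max_eq_left hle] at h
        have hp : p ^ 3 = 0 := h13 h
        rw [hp, map_zero] at hle
        have hq : a * q ^ 3 = 0 := (Valuation.zero_iff _).1 (le_antisymm hle zero_le)
        rw [hp, hq, add_zero]
      · rw [max_eq_right hle] at h
        have hq : a * q ^ 3 = 0 := h23 h
        rw [hq, map_zero] at hle
        have hp : p ^ 3 = 0 := (Valuation.zero_iff _).1 (le_antisymm hle zero_le)
        rw [hp, hq, add_zero]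
    rw [v_add_eq_max' h2, h1, max_assoc]
  by_cases hX : 3 * a * p * q * r = 0
  · rw [hX, sub_zero, hS]
  · have hp : p ≠ 0 := fun h => hX (by rw [h]; ring)
    have hq : q ≠ 0 := fun h => hX (by rw [h]; ring)
    have hr : r ≠ 0 := fun h => hX (by rw [h]; ring)
    have hlt : Valued.v (3 * a * p * q * r) < Valued.v (p ^ 3 + a * q ^ 3 + a ^ 2 * r ^ 3) := by
      rw [hS]
      set e := WithZero.log (Valued.v p) with he
      set f := WithZero.log (Valued.v q) with hf
      set g := WithZero.log (Valued.v r) with hg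
      have hep : Valued.v p = WithZero.exp e := (exp_log_v' hp).symm
      have hfq : Valued.v q = WithZero.exp f := (exp_log_v' hq).symm
      have hgr : Valued.v r = WithZero.exp g := (exp_log_v' hr).symm
      have hX' : Valued.v (3 * a * p * q * r) ≤ WithZero.exp (k + (e + (f + g))) := by
        have hx : Valued.v (3 * a * p * q * r) = Valued.v (3 : K) * WithZero.exp (k + (e + (f + g))) := by
          rw [map_mul, map_mul, map_mul, map_mul, ha, hep, hfq, hgr, WithZero.exp_add, WithZero.exp_add, WithZero.exp_add]
          simp only [mul_assoc]
        rw [hx]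
        calc Valued.v (3 : K) * WithZero.exp (k + (e + (f + g))) ≤ 1 * WithZero.exp (k + (e + (f + g))) := by gcongr
          _ = WithZero.exp (k + (e + (f + g))) := one_mul _
      have hA' : Valued.v (p ^ 3) = WithZero.exp (3 * e) := by
        rw [map_pow, hep, ← WithZero.exp_nsmul]; simp only [nsmul_eq_mul, Nat.cast_ofNat]
      have hB' : Valued.v (a * q ^ 3) = WithZero.exp (k + 3 * f) := by
        rw [map_mul, map_pow, ha, hfq, ← WithZero.exp_nsmul, ← WithZero.exp_add]; simp only [nsmul_eq_mul, Nat.cast_ofNat]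
      have hC' : Valued.v (a ^ 2 * r ^ 3) = WithZero.exp (2 * k + 3 * g) := by
        rw [map_mul, map_pow, map_pow, ha, hgr, ← WithZero.exp_nsmul, ← WithZero.exp_nsmul, ← WithZero.exp_add]
        simp only [nsmul_eq_mul, Nat.cast_ofNat]
      have hdisj : k + (e + (f + g)) < 3 * e ∨ k + (e + (f + g)) < k + 3 * f ∨ k + (e + (f + g)) < 2 * k + 3 * g := by omega
      refine lt_of_le_of_lt hX' ?_
      rcases hdisj with h | h | h
      · exact lt_of_lt_of_le (by rw [hA', WithZero.exp_lt_exp]; exact h) (le_max_left _ _)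
      · exact lt_of_lt_of_le (by rw [hB', WithZero.exp_lt_exp]; exact h) ((le_max_left _ _).trans (le_max_right _ _))
      · exact lt_of_lt_of_le (by rw [hC', WithZero.exp_lt_exp]; exact h) ((le_max_right _ _).trans (le_max_right _ _))
    rw [Valuation.map_sub_eq_of_lt_left _ hlt, hS]

/-- **Bounds for norm-one elements, general non-cube order**: if `v a = exp k`, `3 ∤ k`, `v 3 ≤ 1` and `v (det M(p,q,r)) = 1`, then each pure term is
`≤ 1`: `v p ≤ 1`, `v a · v q³ ≤ 1`, `v a² · v r³ ≤ 1` — the coordinates lie in fixed balls (of radii `exp 0`, `exp ⌊−k∕3⌋`, `exp ⌊−2k∕3⌋`), so the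
torus is bounded. [cite: Rogawski1990, §3.6 p. 31] [cite: PlatonovRapinchuk1994, §6.4 Prop. 6.15] -/
theorem v_pure_le_one_of_v_det_cubicMat_eq_one_of_not_dvd {a : K} {k : ℤ} (ha : Valued.v a = WithZero.exp k) (hk : ¬ (3 : ℤ) ∣ k)
    (h3 : Valued.v (3 : K) ≤ 1) {p q r : K} (hn : Valued.v (p ^ 3 + a * q ^ 3 + a ^ 2 * r ^ 3 - 3 * a * p * q * r) = 1) :
    Valued.v p ≤ 1 ∧ Valued.v a * Valued.v q ^ 3 ≤ 1 ∧ Valued.v a ^ 2 * Valued.v r ^ 3 ≤ 1 := by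
  rw [v_det_cubicMat_eq_max_of_not_dvd ha hk h3] at hn
  have hA : Valued.v (p ^ 3) ≤ 1 := hn ▸ le_max_left _ _
  have hB : Valued.v (a * q ^ 3) ≤ 1 := hn ▸ (le_max_left _ _).trans (le_max_right _ _)
  have hC : Valued.v (a ^ 2 * r ^ 3) ≤ 1 := hn ▸ (le_max_right _ _).trans (le_max_right _ _)
  refine ⟨?_, ?_, ?_⟩
  · rcases eq_or_ne p 0 with rfl | hp
    · simp
    · rw [map_pow, ← exp_log_v' hp, ← WithZero.exp_nsmul, ← WithZero.exp_zero, WithZero.exp_le_exp] at hA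
      rw [← exp_log_v' hp, ← WithZero.exp_zero, WithZero.exp_le_exp]
      simp only [nsmul_eq_mul, Nat.cast_ofNat] at hA
      omega
  · rw [map_mul, map_pow] at hB; exact hB
  · rw [map_mul, map_pow, map_pow] at hC; exact hC

end ValuedGeneral

end Literature.NumberTheory.Rogawski1990.TypeThreeTorus

end
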